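/- Copyright: the b2b-balaban cell (near-miss cell 7), T⁴-continuum fan-out, ROUND-2 swarm `t4-ne7b-formalise-*`
(leaf 03, answering the row owner's INTERFACE REQUEST NE7b IR-41-4 addressed to leaf 08, first refusal honoured on the
journal), row NE7b (node U5c COUNT member).  Released under the licence of the surrounding project. -/
import Summits.QuantumFields.BalabanUV.T4Continuum.Support.HistoryRealiseWeakTimed
import Summits.QuantumFields.BalabanUV.T4Continuum.Support.HistoryRealisePrintReading

/-!
# Memory-agnostic READING carriers: `RealisedReadingW` ∕ `RealisedReadingRW` and the LE term reading from them
(INTERFACE REQUEST NE7b IR-41-4, file 2 of 3; repair route R-41-a of R-OWNER-41-1)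

Summits-side support leaf of the T⁴-continuum cell (rung (B)+1 on a FINITE torus only; NOT infinite volume, NOT the
mass gap, NOT the Clay statement; NOT a proof of the spine estimate NE7b, which is the cell's OWN estimate, NOT PRINTED
and NOT PROVED).  The row owner's INTERFACE REQUEST NE7b IR-41-4 (`HOME/INBOX.md` block «from b2b-balaban-t4-ne7b-p1
gen 41», `CLAIMS.log` l.27257; claim l.27561): the W-twin of row S1b-P2 part 2 `HistoryRealisePrintReading` (leaf-08,
p246985) over the owner's memory-agnostic core `HistoryRealiseWeak` (p248661); file 1 = `HistoryRealiseWeakTimed`.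

WHY.  The ENDs of the COUNT road read the live structures of the bad terms through the hypothesis shapes
`HistoryAssemblyRealiseLE.RealisedReading` (leaf-03, p210803) ∕ `HistoryAssemblyRealiseRun.RealisedReadingR` (leaf-02 g2)
and their print-exact twins `HistoryRealisePrintReading.RealisedReadingP` ∕ `RealisedReadingRP` (leaf-08, p246985), whose
geometric field `real` asks `Realises …` resp. `RealisesP …` — predicates whose RENEWAL clause reads condition (ii)'s
memory FROZEN at the line's last event (the owner's located MODEL finding #3, R-OWNER-41-1; print reads the CURRENT
level's `R_j`: B16 = [Balaban1989LargeFieldII] p. 384, B15 = [Balaban1989LargeFieldI] pp. 177, 198 — manuscripts UNDER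
AUDIT, locators only).  Repair route R-41-a (design rule: the END must not depend on the readiness CONVENTION at all):
THIS FILE carries the MEMORY-AGNOSTIC TWINS of the two reading carriers — `real := ∃ Z, RealisesW … ∧ PendingBefore … K`,
every other field token for token — and re-derives the LE term reading from them through file 1
(`consistentTLE_genT_of_realisesW`, `lt_reach_genT_of_pendingBefore_W`): the SAME `TermReadingLE …` conclusion, so every
END over `TermReadingLE` (`hybridNE7_of_termReadingLE_canon` and its run ∕ pinned ∕ headline descendants) re-plugs BY
NAME (row S12-W, IR-41-5).  The print-exact and the landed carriers IMPLY the memory-agnostic ones (`RealisedReadingP.toW`,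
`RealisedReading.toW`, `RealisedReadingRP.toW`, `RealisedReadingR.toW`).  Append-only: nothing landed is edited.

WHAT.  §1 **`structure RealisedReadingW`**, `RealisedReadingP.toW`, `RealisedReading.toW`, **`termReadingLE_of_realisedW`**.
§2 **`structure RealisedReadingRW`** (profile per cutoff), `RealisedReadingRP.toW`, `RealisedReadingR.toW`,
`RealisedReadingRW.of_realisedReadingW`, **`termReadingLE_of_realisedRW`**.  [folklore] two hypothesis SHAPES (twins of
landed shapes; no `Prop` FACT of print minted) + junction lemmas; nothing printed asserted, no `[cite:]`, zero `sorry`.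

HONEST.  The reading H3^NE7b (that the live structures ARE weakly realised pending pedigrees with root cells), (B) and
the BetaPertH-flow facts stay DISPLAYED; by-name class of every `WALL-NE7b-P1.md` §2 binder UNCHANGED; headline p224237
UNCHANGED BY NAME until S12-W re-plugs; located open point G-M4-1 (touch-connected births) untouched; NE7b NOT proved;
spine 0∕9.  HONEST DEPENDENCY (cell): continuum YM on T⁴ ⇐ BetaPertH ∧ nine spine estimates (0/9 proved); BetaPertH ⇐
(D1) ∧ (D4) ∧ CAP+tail; G-an2-4 gates asym, D1 and NE2/3/4.  This file changes none of it. -/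

open Finset MeasureTheory
open Literature.MathematicalPhysics.QuantumFieldTheory.Balaban1983to89
open T4PersistenceDictionary T4PersistentHistoryCount T4BankedInduction T4PrintedShapeBanking
open T4WeightBudget T4GlobalDenominator T4LiveClassFibration T4LiveStructureGas T4LiveGasToTerms T4RecordPriceSeam
open T4PartnerMultiplicity T4IndicatorShell T4MatchingAssembly T4MatchingClosure T4MatchingClosureSocket T4Continuum
open T4StabilitySocket T4BranchingRecordsGas T4TaggedShapeBanking T4CanonicalMenus T4RenewalChains
open Summit.QuantumFields.BalabanUV.T4Continuum.PlacementBatch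
open Summit.QuantumFields.BalabanUV.T4Continuum.PlacementSkeleton
open Summit.QuantumFields.BalabanUV.T4Continuum.CountThresholdUniform
open Summit.QuantumFields.BalabanUV.T4Continuum.CountThresholdExit
open Summit.QuantumFields.BalabanUV.T4Continuum.CountSeamJunction
open Summit.QuantumFields.BalabanUV.T4Continuum.LateMergers
open Summit.QuantumFields.BalabanUV.T4Continuum.HistoryFlow
open Summit.QuantumFields.BalabanUV.T4Continuum.HistoryRegeneration
open Summit.QuantumFields.BalabanUV.T4Continuum.HistoryTables
open Summit.QuantumFields.BalabanUV.T4Continuum.HistoryAssemblyTrees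
open Summit.QuantumFields.BalabanUV.T4Continuum.HistoryAssemblyTerms
open Summit.QuantumFields.BalabanUV.T4Continuum.HistoryAssemblyPedigree
open Summit.QuantumFields.BalabanUV.T4Continuum.HistoryConstants
open Summit.QuantumFields.BalabanUV.T4Continuum.HistoryGen
open Literature.MathematicalPhysics.QuantumFieldTheory.Balaban1983to89.B13ScaleTransfer
open Summit.QuantumFields.BalabanUV.T4Continuum.ZoneSkeleton
open Summit.QuantumFields.BalabanUV.T4Continuum.HistorySocketTH
open Summit.QuantumFields.BalabanUV.T4Continuum.HistoryCaps
open Summit.QuantumFields.BalabanUV.T4Continuum.HistoryAssemblyPrice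
open Summit.QuantumFields.BalabanUV.T4Continuum.HistoryBankingLE
open Summit.QuantumFields.BalabanUV.T4Continuum.HistoryTreeShapeLE
open Summit.QuantumFields.BalabanUV.T4Continuum.HistoryExitLE
open Summit.QuantumFields.BalabanUV.T4Continuum.HistoryAssemblyTermsLE
open Summit.QuantumFields.BalabanUV.T4Continuum.HistoryRealise
open Summit.QuantumFields.BalabanUV.T4Continuum.HistoryRealisePrint
open Summit.QuantumFields.BalabanUV.T4Continuum.HistoryRealiseWeak
open Summit.QuantumFields.BalabanUV.T4Continuum.HistoryAssemblyRealiseLE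
open Summit.QuantumFields.BalabanUV.T4Continuum.HistoryAssemblyRealiseRun
open Summit.QuantumFields.BalabanUV.T4Continuum.HistoryRealisePrintReading

namespace Summit.QuantumFields.BalabanUV.T4Continuum.HistoryRealiseWeakReading

noncomputable section

/-! ## §1 The per-term reading, memory-agnostic, constant profile -/

section Reading

variable {ι α π γ : Type*} [DecidableEq α] [DecidableEq π] [DecidableEq γ] {d : ℕ}

/-- **THE PER-TERM READING AS WEAKLY REALISED PENDING PEDIGREES** (twin of leaf-03's
`HistoryAssemblyRealiseLE.RealisedReading` and of leaf-08's `HistoryRealisePrintReading.RealisedReadingP`, hypothesis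
SHAPE): for every cutoff `K ≥ K₀` and term `τ ∈ T K`, the encoding facts `renew_step`∕`forest`∕`headOldest`; every live
component's region history is `RealisesW`-realised (renewals: condition (i) at the readiness index + frozen pendency
strictly before it, NO readiness convention; join partners pending STRICTLY BEFORE the join scale) and pending STRICTLY
BEFORE the cutoff `K` (`PendingBefore`); the root-cell facts `cell_mem`∕`cell_inj` (displayed here; discharged from
domains in file 3). [folklore] -/
structure RealisedReadingW (L : ℕ) (s : ℕ → ℕ) (Cell : ℕ → ℕ → Finset γ) (K₀ : ℕ) (R : ℕ → ℕ → ℕ) (T : ℕ → Finset ι)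
    (ped : ℕ → ι → Pedigree α π) (cellP : ℕ → ι → π → Pt d × Finset (Pt d)) (liveC : ℕ → ι → Finset α)
    (cellOf : ℕ → ι → α → γ) : Prop where
  /-- encoding: a renewal is dated one step after the renewed part -/
  renew_step : ∀ K, K₀ ≤ K → ∀ τ ∈ T K, ∀ c c', Part.old c' true ∈ (ped K τ).parts c →
    (ped K τ).step c' + 1 = (ped K τ).step c
  /-- the pedigree is a forest -/
  forest : ∀ K, K₀ ≤ K → ∀ τ ∈ T K, ∀ c, (ped K τ).Forest c
  /-- oldest line first at every component -/
  headOldest : ∀ K, K₀ ≤ K → ∀ τ ∈ T K, ∀ c, (ped K τ).HeadOldest c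
  /-- every live component is weakly realised and pending strictly before the cutoff -/
  real : ∀ K, K₀ ≤ K → ∀ τ ∈ T K, ∀ c ∈ liveC K τ, ∃ Z : Finset (Pt d),
    RealisesW L s (R K) ((ped K τ).toPGen (cellP K τ) c) Z ∧
      PendingBefore L s (R K) ((ped K τ).toPGen (cellP K τ) c).lastStep Z K
  /-- the root cell of a live component is a cell of the root's age -/
  cell_mem : ∀ K, K₀ ≤ K → ∀ τ ∈ T K, ∀ c ∈ liveC K τ, cellOf K τ c ∈ Cell K (K - ((ped K τ).genT c).rootStep)
  /-- distinct live components of one term have distinct root cells -/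
  cell_inj : ∀ K, K₀ ≤ K → ∀ τ ∈ T K, Set.InjOn (cellOf K τ) (liveC K τ : Set α)

variable {L : ℕ} {s : ℕ → ℕ} {C : T4PrintedShapeBanking.Consts} {Cell : ℕ → ℕ → Finset γ} {K₀ : ℕ}
  {R : ℕ → ℕ → ℕ} {T : ℕ → Finset ι} {ped : ℕ → ι → Pedigree α π} {cellP : ℕ → ι → π → Pt d × Finset (Pt d)}
  {liveC : ℕ → ι → Finset α} {cellOf : ℕ → ι → α → γ}

omit [DecidableEq π] [DecidableEq γ] in
/-- **THE PRINT-EXACT READING IMPLIES THE MEMORY-AGNOSTIC ONE** (`realisesW_of_realisesP`). [folklore] -/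
theorem RealisedReadingP.toW (H : RealisedReadingP L s Cell K₀ R T ped cellP liveC cellOf) :
    RealisedReadingW L s Cell K₀ R T ped cellP liveC cellOf where
  renew_step := H.renew_step
  forest := H.forest
  headOldest := H.headOldest
  real K hK τ hτ c hc := by
    obtain ⟨Z, hre, hpend⟩ := H.real K hK τ hτ c hc
    exact ⟨Z, realisesW_of_realisesP _ Z hre, hpend⟩
  cell_mem := H.cell_mem
  cell_inj := H.cell_inj

omit [DecidableEq π] [DecidableEq γ] in
/-- **THE LANDED READING IMPLIES THE MEMORY-AGNOSTIC ONE** (`realisesW_of_realises`, `pendingBefore_of_pendingAt`).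
[folklore] -/
theorem RealisedReading.toW (H : RealisedReading L s Cell K₀ R T ped cellP liveC cellOf) :
    RealisedReadingW L s Cell K₀ R T ped cellP liveC cellOf where
  renew_step := H.renew_step
  forest := H.forest
  headOldest := H.headOldest
  real K hK τ hτ c hc := by
    obtain ⟨Z, hre, hpend⟩ := H.real K hK τ hτ c hc
    exact ⟨Z, realisesW_of_realises _ Z hre, pendingBefore_of_pendingAt hpend⟩
  cell_mem := H.cell_mem
  cell_inj := H.cell_inj

/-- **THE MEMORY-AGNOSTIC READING GIVES THE LE TERM READING** for the member map `memOf`, caps `dcapOf`∕`ncapOf` read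
off the data, any matching scale, under row S1b's side conditions (`4 ≤ L`, drop control, `1 ≤ R K t`, `13 ≤ C.n₁`):
`consistent` by `consistentTLE_genT_of_realisesW`, `pending` by `lt_reach_genT_of_pendingBefore_W` (file 1), `wf` by
`wf_of_consistentTLE_freshT_chrono` with `freshT_genT`∕`chronoC_genT`, `chrono`, `fat_lt`∕`fuel_le`, `cell_mem`, `inj` as in
leaf-03's `termReadingLE_of_realised` ∕ leaf-08's `termReadingLE_of_realisedP` — the SAME `TermReadingLE` conclusion.
[folklore] -/
theorem termReadingLE_of_realisedW (hL : 4 ≤ L) (hdrop : ∀ m, B16SProfile.DropCtl s m) (hn₁ : 13 ≤ C.n₁)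
    (hR1 : ∀ K, K₀ ≤ K → ∀ t, 1 ≤ R K t) (H : RealisedReadingW L s Cell K₀ R T ped cellP liveC cellOf)
    (jstar : ℕ → ℕ) :
    TermReadingLE Prod.fst C Cell (dcapOf Prod.fst T (memOf ped liveC cellOf)) (ncapOf T (memOf ped liveC cellOf))
      jstar K₀ R T (memOf ped liveC cellOf) where
  consistent K hK τ hτ q hq := by
    obtain ⟨c, hc, rfl⟩ := mem_memOf.1 hq
    obtain ⟨Z, hre, hpend⟩ := H.real K hK τ (mem_badTerms.1 hτ).1 c hc
    exact consistentTLE_genT_of_realisesW hL hdrop (hR1 K hK) C hn₁ (ped K τ) (cellP K τ)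
      (H.renew_step K hK τ (mem_badTerms.1 hτ).1) hre hpend.1
  wf K hK τ hτ q hq := by
    obtain ⟨c, hc, rfl⟩ := mem_memOf.1 hq
    obtain ⟨Z, hre, hpend⟩ := H.real K hK τ (mem_badTerms.1 hτ).1 c hc
    exact wf_of_consistentTLE_freshT_chrono
      (consistentTLE_genT_of_realisesW hL hdrop (hR1 K hK) C hn₁ (ped K τ) (cellP K τ)
        (H.renew_step K hK τ (mem_badTerms.1 hτ).1) hre hpend.1)
      (Pedigree.freshT_genT (H.forest K hK τ (mem_badTerms.1 hτ).1) c)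
      (Pedigree.chronoC_genT (H.headOldest K hK τ (mem_badTerms.1 hτ).1) c)
  pending K hK τ hτ q hq := by
    obtain ⟨c, hc, rfl⟩ := mem_memOf.1 hq
    obtain ⟨Z, hre, hpend⟩ := H.real K hK τ (mem_badTerms.1 hτ).1 c hc
    exact lt_reach_genT_of_pendingBefore_W hL hdrop (hR1 K hK) C hn₁ (ped K τ) (cellP K τ)
      (H.renew_step K hK τ (mem_badTerms.1 hτ).1) hre hpend
  cell_mem K hK τ hτ q hq := by
    obtain ⟨c, hc, rfl⟩ := mem_memOf.1 hq
    exact H.cell_mem K hK τ (mem_badTerms.1 hτ).1 c hc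
  chrono K hK τ hτ q hq := by
    obtain ⟨c, -, rfl⟩ := mem_memOf.1 hq
    exact Pedigree.chronoC_genT (H.headOldest K hK τ (mem_badTerms.1 hτ).1) c
  fat_lt K hK τ hτ q hq e he hk :=
    fat_lt_of_mem Prod.fst T (memOf ped liveC cellOf) K₀ K hK τ (mem_badTerms.1 hτ).1 q hq e he hk
  fuel_le K hK τ hτ q hq := fuel_le_of_mem T (memOf ped liveC cellOf) K₀ K hK τ (mem_badTerms.1 hτ).1 q hq
  inj K hK τ hτ := by
    intro q hq q' hq' hs
    obtain ⟨c, hc, rfl⟩ := mem_memOf.1 (Finset.mem_coe.1 hq)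
    obtain ⟨c', hc', rfl⟩ := mem_memOf.1 (Finset.mem_coe.1 hq')
    have hcell : cellOf K τ c = cellOf K τ c' := by
      have := congrArg (fun s : BSlot γ PEv => s.2.1) hs
      simpa [bslotOf] using this
    have hcc : c = c' := H.cell_inj K hK τ (mem_badTerms.1 hτ).1 (Finset.mem_coe.2 hc) (Finset.mem_coe.2 hc') hcell
    subst hcc
    rfl

end Reading

/-! ## §2 The per-term reading, memory-agnostic, profile per cutoff -/

section ReadingR

variable {ι α π γ : Type*} [DecidableEq α] [DecidableEq π] [DecidableEq γ] {d : ℕ}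

/-- **THE PER-TERM READING AS WEAKLY REALISED PENDING PEDIGREES, PROFILE PER CUTOFF** (twin of leaf-02 g2's
`HistoryAssemblyRealiseRun.RealisedReadingR` and of leaf-08's `HistoryRealisePrintReading.RealisedReadingRP`, hypothesis
SHAPE): as `RealisedReadingW` with blocking exponents `s K` of the run with cutoff `K` in `real`. [folklore] -/
structure RealisedReadingRW (L : ℕ) (s : ℕ → ℕ → ℕ) (Cell : ℕ → ℕ → Finset γ) (K₀ : ℕ) (R : ℕ → ℕ → ℕ)
    (T : ℕ → Finset ι) (ped : ℕ → ι → Pedigree α π) (cellP : ℕ → ι → π → Pt d × Finset (Pt d))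
    (liveC : ℕ → ι → Finset α) (cellOf : ℕ → ι → α → γ) : Prop where
  /-- encoding: a renewal is dated one step after the renewed part -/
  renew_step : ∀ K, K₀ ≤ K → ∀ τ ∈ T K, ∀ c c', Part.old c' true ∈ (ped K τ).parts c →
    (ped K τ).step c' + 1 = (ped K τ).step c
  /-- the pedigree is a forest -/
  forest : ∀ K, K₀ ≤ K → ∀ τ ∈ T K, ∀ c, (ped K τ).Forest c
  /-- oldest line first at every component -/
  headOldest : ∀ K, K₀ ≤ K → ∀ τ ∈ T K, ∀ c, (ped K τ).HeadOldest c
  /-- every live component is weakly realised by the run's blockings and pending strictly before the cutoff -/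
  real : ∀ K, K₀ ≤ K → ∀ τ ∈ T K, ∀ c ∈ liveC K τ, ∃ Z : Finset (Pt d),
    RealisesW L (s K) (R K) ((ped K τ).toPGen (cellP K τ) c) Z ∧
      PendingBefore L (s K) (R K) ((ped K τ).toPGen (cellP K τ) c).lastStep Z K
  /-- the root cell of a live component is a cell of the root's age -/
  cell_mem : ∀ K, K₀ ≤ K → ∀ τ ∈ T K, ∀ c ∈ liveC K τ, cellOf K τ c ∈ Cell K (K - ((ped K τ).genT c).rootStep)
  /-- distinct live components of one term have distinct root cells -/
  cell_inj : ∀ K, K₀ ≤ K → ∀ τ ∈ T K, Set.InjOn (cellOf K τ) (liveC K τ : Set α)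

variable {L : ℕ} {Cell : ℕ → ℕ → Finset γ} {K₀ : ℕ} {R : ℕ → ℕ → ℕ} {T : ℕ → Finset ι}
  {ped : ℕ → ι → Pedigree α π} {cellP : ℕ → ι → π → Pt d × Finset (Pt d)} {liveC : ℕ → ι → Finset α}
  {cellOf : ℕ → ι → α → γ}

omit [DecidableEq π] [DecidableEq γ] in
/-- **THE PRINT-EXACT PER-RUN READING IMPLIES THE MEMORY-AGNOSTIC ONE.** [folklore] -/
theorem RealisedReadingRP.toW {s : ℕ → ℕ → ℕ} (H : RealisedReadingRP L s Cell K₀ R T ped cellP liveC cellOf) :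
    RealisedReadingRW L s Cell K₀ R T ped cellP liveC cellOf where
  renew_step := H.renew_step
  forest := H.forest
  headOldest := H.headOldest
  real K hK τ hτ c hc := by
    obtain ⟨Z, hre, hpend⟩ := H.real K hK τ hτ c hc
    exact ⟨Z, realisesW_of_realisesP _ Z hre, hpend⟩
  cell_mem := H.cell_mem
  cell_inj := H.cell_inj

omit [DecidableEq π] [DecidableEq γ] in
/-- **THE LANDED PER-RUN READING IMPLIES THE MEMORY-AGNOSTIC ONE.** [folklore] -/
theorem RealisedReadingR.toW {s : ℕ → ℕ → ℕ} (H : RealisedReadingR L s Cell K₀ R T ped cellP liveC cellOf) :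
    RealisedReadingRW L s Cell K₀ R T ped cellP liveC cellOf where
  renew_step := H.renew_step
  forest := H.forest
  headOldest := H.headOldest
  real K hK τ hτ c hc := by
    obtain ⟨Z, hre, hpend⟩ := H.real K hK τ hτ c hc
    exact ⟨Z, realisesW_of_realises _ Z hre, pendingBefore_of_pendingAt hpend⟩
  cell_mem := H.cell_mem
  cell_inj := H.cell_inj

omit [DecidableEq π] [DecidableEq γ] in
/-- a constant profile is a per-cutoff profile (memory-agnostic form) [folklore] -/
theorem RealisedReadingRW.of_realisedReadingW {s : ℕ → ℕ}
    (H : RealisedReadingW L s Cell K₀ R T ped cellP liveC cellOf) :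
    RealisedReadingRW L (fun _ => s) Cell K₀ R T ped cellP liveC cellOf where
  renew_step := H.renew_step
  forest := H.forest
  headOldest := H.headOldest
  real := H.real
  cell_mem := H.cell_mem
  cell_inj := H.cell_inj

variable {s : ℕ → ℕ → ℕ} {C : T4PrintedShapeBanking.Consts}

/-- **THE MEMORY-AGNOSTIC PER-CUTOFF READING GIVES THE LE TERM READING** under the side conditions `4 ≤ L`, drop
control of each profile `s K` (`K ≥ K₀`), `1 ≤ R K t`, `13 ≤ C.n₁` (twin of leaf-02 g2's `termReadingLE_of_realisedR` ∕
leaf-08's `termReadingLE_of_realisedRP`, file 1's lemmas applied at each cutoff). [folklore] -/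
theorem termReadingLE_of_realisedRW (hL : 4 ≤ L) (hdrop : ∀ K, K₀ ≤ K → ∀ m, B16SProfile.DropCtl (s K) m)
    (hn₁ : 13 ≤ C.n₁) (hR1 : ∀ K, K₀ ≤ K → ∀ t, 1 ≤ R K t)
    (H : RealisedReadingRW L s Cell K₀ R T ped cellP liveC cellOf) (jstar : ℕ → ℕ) :
    TermReadingLE Prod.fst C Cell (dcapOf Prod.fst T (memOf ped liveC cellOf)) (ncapOf T (memOf ped liveC cellOf))
      jstar K₀ R T (memOf ped liveC cellOf) where
  consistent K hK τ hτ q hq := by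
    obtain ⟨c, hc, rfl⟩ := mem_memOf.1 hq
    obtain ⟨Z, hre, hpend⟩ := H.real K hK τ (mem_badTerms.1 hτ).1 c hc
    exact consistentTLE_genT_of_realisesW hL (hdrop K hK) (hR1 K hK) C hn₁ (ped K τ) (cellP K τ)
      (H.renew_step K hK τ (mem_badTerms.1 hτ).1) hre hpend.1
  wf K hK τ hτ q hq := by
    obtain ⟨c, hc, rfl⟩ := mem_memOf.1 hq
    obtain ⟨Z, hre, hpend⟩ := H.real K hK τ (mem_badTerms.1 hτ).1 c hc
    exact wf_of_consistentTLE_freshT_chrono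
      (consistentTLE_genT_of_realisesW hL (hdrop K hK) (hR1 K hK) C hn₁ (ped K τ) (cellP K τ)
        (H.renew_step K hK τ (mem_badTerms.1 hτ).1) hre hpend.1)
      (Pedigree.freshT_genT (H.forest K hK τ (mem_badTerms.1 hτ).1) c)
      (Pedigree.chronoC_genT (H.headOldest K hK τ (mem_badTerms.1 hτ).1) c)
  pending K hK τ hτ q hq := by
    obtain ⟨c, hc, rfl⟩ := mem_memOf.1 hq
    obtain ⟨Z, hre, hpend⟩ := H.real K hK τ (mem_badTerms.1 hτ).1 c hc
    exact lt_reach_genT_of_pendingBefore_W hL (hdrop K hK) (hR1 K hK) C hn₁ (ped K τ) (cellP K τ)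
      (H.renew_step K hK τ (mem_badTerms.1 hτ).1) hre hpend
  cell_mem K hK τ hτ q hq := by
    obtain ⟨c, hc, rfl⟩ := mem_memOf.1 hq
    exact H.cell_mem K hK τ (mem_badTerms.1 hτ).1 c hc
  chrono K hK τ hτ q hq := by
    obtain ⟨c, -, rfl⟩ := mem_memOf.1 hq
    exact Pedigree.chronoC_genT (H.headOldest K hK τ (mem_badTerms.1 hτ).1) c
  fat_lt K hK τ hτ q hq e he hk :=
    fat_lt_of_mem Prod.fst T (memOf ped liveC cellOf) K₀ K hK τ (mem_badTerms.1 hτ).1 q hq e he hk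
  fuel_le K hK τ hτ q hq := fuel_le_of_mem T (memOf ped liveC cellOf) K₀ K hK τ (mem_badTerms.1 hτ).1 q hq
  inj K hK τ hτ := by
    intro q hq q' hq' hs
    obtain ⟨c, hc, rfl⟩ := mem_memOf.1 (Finset.mem_coe.1 hq)
    obtain ⟨c', hc', rfl⟩ := mem_memOf.1 (Finset.mem_coe.1 hq')
    have hcell : cellOf K τ c = cellOf K τ c' := by
      have := congrArg (fun s : BSlot γ PEv => s.2.1) hs
      simpa [bslotOf] using this
    have hcc : c = c' := H.cell_inj K hK τ (mem_badTerms.1 hτ).1 (Finset.mem_coe.2 hc) (Finset.mem_coe.2 hc') hcell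
    subst hcc
    rfl

end ReadingR

end

end Summit.QuantumFields.BalabanUV.T4Continuum.HistoryRealiseWeakReading
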